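import Summits.QuantumFields.YangMills.Theorems.SwapVirialDeficitBlowUpGnomonicAngleChartDefs
import Summits.QuantumFields.YangMills.Theorems.SwapVirialDeficitConeMeasureHubCot
import HarnessLib

/-!
# THE HUB LETTER `δ` AND THE HUB ANGLE `θ = π/2 − arctan δ` — bridge between the `δ`-letters of the end core and w2 g60's angle chart
# (free-hands support of ⟨stmt-QuantumFields-24197⟩ `SwapVirialDeficit.SwapGluedStiffness`; LEAD g99 memo11 §2(g), the angle matching of `stub_end_gaussCore`)

The end core and the bulk main term are `δ`-integrals (`δ = re a/‖im a‖`, hub `hubAt δ 1 = (δ, 1, 0, 0)`; ✓`setLIntegral_endCore_eq_hubCot`,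
✓`setIntegral_planeMass_hubBulk_eq_hubCot`), while w2's follower-determinant Lipschitz laws (✓`abs_log_det_gnoFolHessian_sub_le_joint` etc.) are stated
at hubs `angUnit θ` with `0 ≤ sin θ`.  This file is the dictionary: `θ(δ) = π/2 − arctan δ ∈ (0, π)`, `sin θ(δ) = (√(1+δ²))⁻¹ > 0`, `cos θ(δ) = δ/√(1+δ²)`,
`angUnit θ(δ) = (√(1+δ²))⁻¹ • hubAt δ 1`, ★ `gnoDeficit z χ (hubAt δ 1) ε η = gnoDeficitAng z χ θ(δ) ε η = gnoDeficit z χ (angUnit θ(δ)) ε η`, and the matching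
distance ★ `|θ(δ) − θ(δ′)| ≤ |δ − δ′|` (`arctan` is 1-Lipschitz).

HONEST LABEL: elementary; `stub_end_gaussCore`, stubs core-tip ∕ 001-good of ➎, ⟨24197⟩ ∕ ⟨24194⟩ OPEN; own crux ⟨22884⟩ `LargeFieldMassRefinementTail` OPEN
(blocked-on ⟨19935⟩); the Yang–Mills mass gap is NOT proved; no summit is proved by a line.  THEOREMS ONLY (0 `def`, 0 `sorry`, no instance), standard axioms.
LEAD seat ym-line-sfw-p2 g99 (cell ym-idea-1, free hands), `--supports stmt-QuantumFields-24197`.  References: [folklore].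
-/

set_option autoImplicit false
set_option synthInstance.maxSize 1024

noncomputable section

open Quaternion Set
open scoped Quaternion BigOperators
open Literature.MathematicalPhysics.QuantumLattice
open Literature.MathematicalPhysics.QuantumFieldTheory hiding SU2

namespace Summit.QuantumFields.YangMills.Theorems.SwapVirialDeficit.BlowUpRing

open Summit.QuantumFields.YangMills.Theorems.FemtoTransferGap
open Summit.QuantumFields.YangMills.Theorems.FemtoTransferGap.TT

variable {L : ℕ} [NeZero L]

/-! ## §1 The hub angle of the letter `δ` -/

/-- `sin(π/2 − arctan δ) = (√(1+δ²))⁻¹`. [folklore] -/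
theorem sin_hubAngle (δ : ℝ) : Real.sin (Real.pi / 2 - Real.arctan δ) = (Real.sqrt (1 + δ ^ 2))⁻¹ := by
  rw [Real.sin_pi_div_two_sub, Real.cos_arctan, one_div]

/-- `cos(π/2 − arctan δ) = δ/√(1+δ²)`. [folklore] -/
theorem cos_hubAngle (δ : ℝ) : Real.cos (Real.pi / 2 - Real.arctan δ) = δ / Real.sqrt (1 + δ ^ 2) := by
  rw [Real.cos_pi_div_two_sub, Real.sin_arctan]

/-- `0 < π/2 − arctan δ < π`. [folklore] -/
theorem hubAngle_mem (δ : ℝ) : 0 < Real.pi / 2 - Real.arctan δ ∧ Real.pi / 2 - Real.arctan δ < Real.pi := by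
  have h1 := Real.arctan_lt_pi_div_two δ
  have h2 := Real.neg_pi_div_two_lt_arctan δ
  constructor <;> linarith

/-- `0 < sin(π/2 − arctan δ)`. [folklore] -/
theorem sin_hubAngle_pos (δ : ℝ) : 0 < Real.sin (Real.pi / 2 - Real.arctan δ) := by
  rw [sin_hubAngle]; positivity

/-- ★ `angUnit (π/2 − arctan δ) = (√(1+δ²))⁻¹ • hubAt δ 1`. [folklore] -/
theorem angUnit_hubAngle (δ : ℝ) : angUnit (Real.pi / 2 - Real.arctan δ) = (Real.sqrt (1 + δ ^ 2))⁻¹ • hubAt δ 1 := by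
  unfold angUnit
  rw [cos_hubAngle, sin_hubAngle]
  ext <;> simp [hubAt, Real.sqrt_one, div_eq_mul_inv, mul_comm]

/-- The hub-polar letter of `angUnit (π/2 − arctan δ)` is `δ`: `re/‖im‖ = δ`. [folklore] -/
theorem re_div_norm_im_angUnit_hubAngle (δ : ℝ) :
    (angUnit (Real.pi / 2 - Real.arctan δ)).re / ‖(angUnit (Real.pi / 2 - Real.arctan δ)).im‖ = δ := by
  have hs : 0 < Real.sqrt (1 + δ ^ 2) := Real.sqrt_pos.2 (by positivity)
  rw [norm_im_angUnit, abs_of_pos (sin_hubAngle_pos δ), angUnit_re, cos_hubAngle, sin_hubAngle]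
  field_simp

/-! ## §2 The deficit at `hubAt δ 1` in the angle chart -/

/-- ★ `F̂(hubAt δ 1, ε, η) = F̂(angUnit (π/2 − arctan δ), ε, η)` (the deficit sees the hub only through `re/‖im‖`, ✓`gnoDeficit_eq_hubCot`). [folklore] -/
theorem gnoDeficit_hubAt_eq_angUnit (z : Fin 3 → Bool) (χ : Site 3 L → SU2) (δ : ℝ) (ε : GnoSign L) (η : GnoCoord L) :
    gnoDeficit z χ (hubAt δ 1) ε η = gnoDeficit z χ (angUnit (Real.pi / 2 - Real.arctan δ)) ε η := by
  have him : (angUnit (Real.pi / 2 - Real.arctan δ)).im ≠ 0 := by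
    intro h
    have h1 := norm_im_angUnit (Real.pi / 2 - Real.arctan δ)
    rw [h, norm_zero] at h1
    exact (sin_hubAngle_pos δ).ne' (abs_eq_zero.1 h1.symm)
  rw [gnoDeficit_eq_hubCot z χ him, re_div_norm_im_angUnit_hubAngle]

/-- ★ `F̂(hubAt δ 1, ε, η) = gnoDeficitAng (π/2 − arctan δ) ε η` (w2 g60's angle chart ✓`gnoDeficit_angUnit`). [folklore] -/
theorem gnoDeficit_hubAt_eq_ang (z : Fin 3 → Bool) (χ : Site 3 L → SU2) (δ : ℝ) (ε : GnoSign L) (η : GnoCoord L) :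
    gnoDeficit z χ (hubAt δ 1) ε η = gnoDeficitAng z χ (Real.pi / 2 - Real.arctan δ) ε η := by
  rw [gnoDeficit_hubAt_eq_angUnit, gnoDeficit_angUnit z χ (sin_hubAngle_pos δ).le]

/-! ## §3 The matching distance -/

/-- `arctan` is 1-Lipschitz: `|arctan δ − arctan δ′| ≤ |δ − δ′|`. [folklore] -/
theorem abs_arctan_sub_arctan_le (δ δ' : ℝ) : |Real.arctan δ - Real.arctan δ'| ≤ |δ - δ'| := by
  have hd : ∀ x ∈ (univ : Set ℝ), DifferentiableAt ℝ Real.arctan x := fun x _ => Real.differentiableAt_arctan x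
  have hb : ∀ x ∈ (univ : Set ℝ), ‖deriv Real.arctan x‖ ≤ 1 := by
    intro x _
    rw [Real.deriv_arctan, Real.norm_eq_abs, abs_of_pos (by positivity)]
    rw [div_le_one (by positivity)]
    nlinarith [sq_nonneg x]
  have h := Convex.norm_image_sub_le_of_norm_deriv_le hd hb convex_univ (mem_univ δ') (mem_univ δ)
  rw [Real.norm_eq_abs, Real.norm_eq_abs, one_mul] at h
  exact h

/-- ★ **THE MATCHING DISTANCE**: `|θ(δ) − θ(δ′)| ≤ |δ − δ′|` for `θ(δ) = π/2 − arctan δ`. [folklore] -/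
theorem abs_hubAngle_sub_le (δ δ' : ℝ) : |(Real.pi / 2 - Real.arctan δ) - (Real.pi / 2 - Real.arctan δ')| ≤ |δ - δ'| := by
  have e : (Real.pi / 2 - Real.arctan δ) - (Real.pi / 2 - Real.arctan δ') = -(Real.arctan δ - Real.arctan δ') := by ring
  rw [e, abs_neg]
  exact abs_arctan_sub_arctan_le δ δ'

/-- On the end slab `|δ| < s` and the shell `|δ′| ≤ r` the hub angles differ by at most `s + r`. [folklore] -/
theorem abs_hubAngle_sub_le_of_slab_shell {δ δ' s r : ℝ} (hδ : |δ| < s) (hδ' : |δ'| ≤ r) :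
    |(Real.pi / 2 - Real.arctan δ) - (Real.pi / 2 - Real.arctan δ')| ≤ s + r := by
  refine (abs_hubAngle_sub_le δ δ').trans ((abs_sub _ _).trans ?_)
  linarith

end Summit.QuantumFields.YangMills.Theorems.SwapVirialDeficit.BlowUpRing

end
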